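import Mathlib
import Literature.Computability.AlgebraicComplexity.BurgisserBooleanPartsA3Steps

/-!
# LangWeilTransfer, support `TameResolution` (stmt-6378) / crux `TameTransfer` (stmt-6373) —
# preliminaries for the elementary factor weight bound

Route `LangWeilTransfer` of `ValiantsHypothesis`. Tools for `LangWeilTransferTameResolutionFactorWeight`
(`wt G ≤ wt F · ((D+1)(2D+1)^{2D})ⁿ` for `G ∣ F ≠ 0` in `ℤ[X_0..X_{n-1}]` with partial degrees `≤ D`,
by Lagrange interpolation in every variable):

* weight calculus complements (`weight_C_mul`, `weight_eq_zero_iff`;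
  `wt` = `Literature.Computability.AlgebraicComplexity.weight`);
* weights through `finSuccEquiv : ℤ[X_0..X_n] ≃ ℤ[X_1..X_n][X_0]` (`weight_eq_sum_weight_coeff`:
  the weight splits over the `X_0`-degree; `weight_eval_C_le`: `wt F(a, ·) ≤ M^N wt F` for
  `|a| ≤ M`; `degreeOf_eval_C_le`);
* integral Lagrange interpolation with integer nodes over `R = ℤ[X_1..X_n]`, denominators cleared
  (`lagrange_identity`: `(∏_a Δ_a) Qp = Σ_a Qp(a) (∏_{a'≠a} Δ_{a'}) N_a` for `deg Qp < |A|`), and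
  the supply of good nodes (`exists_good_nodes`: a non-zero `P` of degree `≤ D` has `e + 1 ≤ D + 1`
  non-roots among `0, …, 2D`).

Honest framing: helper lemmas `--supports` an open crux of a conditional route; VP ≠ VNP is NOT
proved and nothing here bears on it.
-/

noncomputable section

open MvPolynomial Polynomial
open scoped BigOperators

-- the summit and the problem share the name `ValiantsHypothesis` (D-0017 single-conjunct layout)
set_option linter.dupNamespace false

namespace Summit.ValiantsHypothesis.ValiantsHypothesis.Theorems.LangWeilTransfer

open Literature.Computability.AlgebraicComplexity

/-! ## Weight calculus complements -/

section WeightCalc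

variable {σ : Type*}

/-- `wt(C c · f) = |c| · wt(f)`. -/
theorem weight_C_mul (c : ℤ) (f : MvPolynomial σ ℤ) :
    weight (MvPolynomial.C c * f) = c.natAbs * weight f := by
  classical
  rcases eq_or_ne c 0 with rfl | hc
  · simp
  have hsupp : (MvPolynomial.C c * f).support = f.support := by
    ext m
    rw [MvPolynomial.mem_support_iff, MvPolynomial.mem_support_iff, MvPolynomial.coeff_C_mul]
    exact ⟨fun h => right_ne_zero_of_mul h, fun h => mul_ne_zero hc h⟩
  unfold weight
  rw [hsupp, Finset.mul_sum]
  refine Finset.sum_congr rfl fun m _ => ?_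
  rw [MvPolynomial.coeff_C_mul, Int.natAbs_mul]

/-- `wt(f) = 0 ↔ f = 0`. -/
theorem weight_eq_zero_iff (f : MvPolynomial σ ℤ) : weight f = 0 ↔ f = 0 := by
  constructor
  · intro h
    unfold weight at h
    rw [Finset.sum_eq_zero_iff] at h
    ext m
    by_cases hm : m ∈ f.support
    · have := h m hm
      rw [Int.natAbs_eq_zero] at this
      rw [this, MvPolynomial.coeff_zero]
    · rw [MvPolynomial.notMem_support_iff.mp hm, MvPolynomial.coeff_zero]
  · rintro rfl; exact weight_zero

end WeightCalc

/-! ## Weights through `finSuccEquiv`: `ℤ[X_0..X_n] ≅ ℤ[X_1..X_n][X_0]` -/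

section FinSucc

variable {n : ℕ}

/-- `finSuccEquiv (rename succ g) = C g`. -/
theorem finSuccEquiv_rename_succ (g : MvPolynomial (Fin n) ℤ) :
    finSuccEquiv ℤ n (rename Fin.succ g) = Polynomial.C g := by
  induction g using MvPolynomial.induction_on with
  | C a => rw [rename_C, finSuccEquiv_apply, eval₂Hom_C, RingHom.comp_apply]
  | add p q hp hq => rw [map_add, map_add, hp, hq, map_add]
  | mul_X p i hp => rw [map_mul, rename_X, map_mul, finSuccEquiv_X_succ, hp, ← map_mul]

/-- `(finSuccEquiv ℤ n)⁻¹ (C g) = rename succ g`. -/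
theorem finSuccEquiv_symm_C (g : MvPolynomial (Fin n) ℤ) :
    (finSuccEquiv ℤ n).symm (Polynomial.C g) = rename Fin.succ g := by
  rw [← finSuccEquiv_rename_succ, AlgEquiv.symm_apply_apply]

/-- `(finSuccEquiv ℤ n)⁻¹ X = X_0`. -/
theorem finSuccEquiv_symm_X : (finSuccEquiv ℤ n).symm Polynomial.X = X 0 := by
  rw [← finSuccEquiv_X_zero, AlgEquiv.symm_apply_apply]

/-- Weight of a constant of `R[X_0]`, `R = ℤ[X_1..X_n]`, read back in `ℤ[X_0..X_n]`. -/
theorem weight_finSuccEquiv_symm_C (g : MvPolynomial (Fin n) ℤ) :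
    weight ((finSuccEquiv ℤ n).symm (Polynomial.C g)) = weight g := by
  rw [finSuccEquiv_symm_C, weight_rename_of_injective (Fin.succ_injective n)]

/-- **The weight splits over the `X_0`-degree**: `wt F = Σ_k wt (coeff_k F)` where `coeff_k F` are
the coefficients of `F` viewed in `ℤ[X_1..X_n][X_0]`. -/
theorem weight_eq_sum_weight_coeff (F : MvPolynomial (Fin (n + 1)) ℤ) :
    weight F = ∑ k ∈ (finSuccEquiv ℤ n F).support, weight ((finSuccEquiv ℤ n F).coeff k) := by
  classical
  unfold weight
  -- regroup the monomials of `F` by their `X_0`-exponent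
  rw [support_finSuccEquiv, ← Finset.sum_fiberwise_of_maps_to
    (s := F.support) (t := Finset.image (fun m : Fin (n + 1) →₀ ℕ => m 0) F.support)
    (g := fun m : Fin (n + 1) →₀ ℕ => m 0) (fun m hm => Finset.mem_image_of_mem _ hm)]
  refine Finset.sum_congr rfl fun k _ => ?_
  rw [← image_support_finSuccEquiv, Finset.sum_image]
  · refine Finset.sum_congr rfl fun m _ => ?_
    rw [finSuccEquiv_coeff_coeff]
  · intro a _ b _ h
    simpa using congrArg Finsupp.tail h

/-- Weight of a product `C g · N` in `R[X_0]` read back in `ℤ[X_0..X_n]`: `≤ wt g · wt N`. -/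
theorem weight_finSuccEquiv_symm_C_mul_le (g : MvPolynomial (Fin n) ℤ)
    (N : Polynomial (MvPolynomial (Fin n) ℤ)) :
    weight ((finSuccEquiv ℤ n).symm (Polynomial.C g * N)) ≤
      weight g * weight ((finSuccEquiv ℤ n).symm N) := by
  rw [map_mul, ← weight_finSuccEquiv_symm_C g]
  exact weight_mul_le _ _

/-- Weight of `X_0 - b`: `≤ 1 + |b|`. -/
theorem weight_finSuccEquiv_symm_X_sub_C_le (b : ℤ) :
    weight ((finSuccEquiv ℤ n).symm (Polynomial.X - Polynomial.C (MvPolynomial.C b))) ≤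
      1 + b.natAbs := by
  rw [map_sub, sub_eq_add_neg]
  refine (weight_add_le _ _).trans ?_
  rw [weight_neg, finSuccEquiv_symm_C, rename_C, weight_C, finSuccEquiv_symm_X, weight_X]

/-- Weight of an evaluation `F(a, X_1..X_n) = Σ_k coeff_k F · a^k`: at most `M^N · wt F` when
`|a| ≤ M` (`M ≥ 1`) and `deg_{X_0} F ≤ N`. -/
theorem weight_eval_C_le (F : MvPolynomial (Fin (n + 1)) ℤ) (a : ℤ) {M N : ℕ} (hM : 1 ≤ M)
    (ha : a.natAbs ≤ M) (hN : (finSuccEquiv ℤ n F).natDegree ≤ N) :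
    weight ((finSuccEquiv ℤ n F).eval (MvPolynomial.C a)) ≤ M ^ N * weight F := by
  classical
  rw [Polynomial.eval_eq_sum, Polynomial.sum_def, weight_eq_sum_weight_coeff F, Finset.mul_sum]
  refine (weight_finset_sum_le _ _).trans (Finset.sum_le_sum fun k hk => ?_)
  rw [mul_comm, ← MvPolynomial.C_pow, weight_C_mul, Int.natAbs_pow]
  refine Nat.mul_le_mul_right _ ((Nat.pow_le_pow_left ha k).trans ?_)
  exact Nat.pow_le_pow_right hM ((Polynomial.le_natDegree_of_mem_supp k hk).trans hN)

/-- The evaluation `X_0 ↦ a` keeps partial degrees in the other variables: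
`deg_{X_j} F(a, ·) ≤ deg_{X_{j+1}} F`. -/
theorem degreeOf_eval_C_le (F : MvPolynomial (Fin (n + 1)) ℤ) (a : ℤ) (j : Fin n) :
    degreeOf j ((finSuccEquiv ℤ n F).eval (MvPolynomial.C a)) ≤ degreeOf j.succ F := by
  classical
  rw [Polynomial.eval_eq_sum, Polynomial.sum_def]
  refine (degreeOf_sum_le _ _ _).trans (Finset.sup_le fun k _ => ?_)
  refine (degreeOf_mul_le _ _ _).trans ?_
  rw [← MvPolynomial.C_pow, degreeOf_C, add_zero]
  exact degreeOf_coeff_finSuccEquiv F j k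

end FinSucc

/-! ## Lagrange interpolation with integer nodes over `R = ℤ[X_1..X_n]`, denominators cleared -/

section Lagrange

variable {n : ℕ}

/-- Values of the node polynomial `N_a = ∏_{b ∈ A ∖ a} (X - b)` at the nodes: `N_a(a) = Δ_a`,
`N_a(a') = 0` for `a' ≠ a` in `A`, where `Δ_a = ∏_{b ≠ a} (a - b)`. -/
theorem eval_nodePoly (A : Finset ℤ) (a a' : ℤ) (ha' : a' ∈ A) :
    (∏ b ∈ A.erase a, (Polynomial.X - Polynomial.C (MvPolynomial.C b) :
        Polynomial (MvPolynomial (Fin n) ℤ))).eval (MvPolynomial.C a') =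
      if a' = a then MvPolynomial.C (∏ b ∈ A.erase a, (a - b)) else 0 := by
  rw [Polynomial.eval_prod]
  simp only [Polynomial.eval_sub, Polynomial.eval_X, Polynomial.eval_C, ← map_sub]
  split_ifs with h
  · subst h
    rw [← map_prod]
  · rw [← map_prod]
    rw [Finset.prod_eq_zero (Finset.mem_erase.mpr ⟨h, ha'⟩) (sub_self _), map_zero]

/-- **Integral Lagrange interpolation identity** over `R = ℤ[X_1..X_n]`. For a finite set `A` of
integer nodes and `Qp ∈ R[X]` of degree `< |A|`:
`(∏_{a∈A} Δ_a) · Qp = Σ_{a∈A} Qp(a) · (∏_{a'∈A, a'≠a} Δ_{a'}) · N_a`. -/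
theorem lagrange_identity (A : Finset ℤ) (Qp : Polynomial (MvPolynomial (Fin n) ℤ))
    (hdeg : Qp.natDegree < A.card) :
    Polynomial.C (MvPolynomial.C (∏ a ∈ A, ∏ b ∈ A.erase a, (a - b))) * Qp =
      ∑ a ∈ A, Polynomial.C (Qp.eval (MvPolynomial.C a)) *
        (Polynomial.C (MvPolynomial.C (∏ a' ∈ A.erase a, ∏ b ∈ A.erase a', (a' - b))) *
          ∏ b ∈ A.erase a, (Polynomial.X - Polynomial.C (MvPolynomial.C b))) := by
  classical
  have hApos : 0 < A.card := lt_of_le_of_lt (Nat.zero_le _) hdeg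
  -- both sides have degree `< |A|` and agree at the `|A|` nodes
  apply Polynomial.eq_of_natDegree_lt_card_of_eval_eq
    (f := fun a : A => (MvPolynomial.C ((a : ℤ)) : MvPolynomial (Fin n) ℤ))
  · intro a b h
    exact Subtype.ext (MvPolynomial.C_injective _ _ h)
  · rintro ⟨a₀, ha₀⟩
    simp only [Polynomial.eval_mul, Polynomial.eval_C, Polynomial.eval_finsetSum]
    rw [Finset.sum_eq_single a₀]
    · rw [eval_nodePoly A a₀ a₀ ha₀, if_pos rfl, ← Finset.prod_erase_mul _ _ ha₀, map_mul]
      ring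
    · intro a _ hne
      rw [eval_nodePoly A a a₀ ha₀, if_neg hne.symm, mul_zero, mul_zero]
    · intro h; exact absurd ha₀ h
  · rw [Fintype.card_coe]
    refine max_lt ((Polynomial.natDegree_C_mul_le _ _).trans_lt hdeg) ?_
    refine lt_of_le_of_lt (Polynomial.natDegree_sum_le_of_forall_le _ _ fun a ha => ?_)
      (Nat.sub_lt hApos Nat.one_pos)
    refine (Polynomial.natDegree_C_mul_le _ _).trans ((Polynomial.natDegree_C_mul_le _ _).trans ?_)
    refine (Polynomial.natDegree_prod_le _ _).trans ?_
    refine (Finset.sum_le_sum fun b _ => Polynomial.natDegree_X_sub_C_le _).trans ?_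
    rw [Finset.sum_const, smul_eq_mul, mul_one, Finset.card_erase_of_mem ha]

/-- There are enough good integer nodes: if `P ∈ R[X]` is non-zero of degree `≤ D`, then among the
integers `0, …, 2D` there are `e + 1` (any `e ≤ D`) that are not roots of `P`. -/
theorem exists_good_nodes (P : Polynomial (MvPolynomial (Fin n) ℤ)) (hP : P ≠ 0) {D : ℕ}
    (hD : P.natDegree ≤ D) {e : ℕ} (he : e ≤ D) :
    ∃ A : Finset ℤ, A.card = e + 1 ∧ (∀ a ∈ A, 0 ≤ a ∧ a ≤ 2 * D) ∧
      ∀ a ∈ A, P.eval (MvPolynomial.C a) ≠ 0 := by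
  classical
  set S : Finset ℤ := (Finset.range (2 * D + 1)).image (fun k : ℕ => (k : ℤ)) with hS
  set bad : Finset ℤ := S.filter fun a => P.eval (MvPolynomial.C a) = 0 with hbad
  set good : Finset ℤ := S.filter fun a => ¬ P.eval (MvPolynomial.C a) = 0 with hgood
  have hScard : S.card = 2 * D + 1 := by
    rw [hS, Finset.card_image_of_injective _ (fun a b h => by exact_mod_cast h), Finset.card_range]
  -- at most `D` bad nodes: they are roots of `P`
  have hbad_le : bad.card ≤ D := by
    by_contra hlt
    have hcard : P.natDegree < Fintype.card bad := by rw [Fintype.card_coe]; omega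
    apply hP
    refine Polynomial.eq_zero_of_natDegree_lt_card_of_eval_eq_zero P
      (f := fun a : bad => (MvPolynomial.C ((a : ℤ)) : MvPolynomial (Fin n) ℤ))
      (fun a b h => Subtype.ext (MvPolynomial.C_injective _ _ h)) (fun a => ?_) hcard
    exact (Finset.mem_filter.mp a.2).2
  have hsplit : bad.card + good.card = S.card := by
    rw [hbad, hgood, Finset.card_filter_add_card_filter_not]
  have hgood_ge : e + 1 ≤ good.card := by omega
  obtain ⟨A, hAsub, hAcard⟩ := Finset.exists_subset_card_eq hgood_ge
  refine ⟨A, hAcard, fun a ha => ?_, fun a ha => ?_⟩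
  · have hmem := hAsub ha
    rw [hgood, Finset.mem_filter, hS, Finset.mem_image] at hmem
    obtain ⟨⟨k, hk, rfl⟩, -⟩ := hmem
    rw [Finset.mem_range] at hk
    exact ⟨by positivity, by exact_mod_cast (by omega : k ≤ 2 * D)⟩
  · have hmem := hAsub ha
    rw [hgood, Finset.mem_filter] at hmem
    exact hmem.2

end Lagrange

end Summit.ValiantsHypothesis.ValiantsHypothesis.Theorems.LangWeilTransfer

end
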